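import Summits.QuantumFields.YangMills.Theorems.IR.EsPolymerClusterTail

/-!
# Crux `IR` (item stmt-QuantumFields-19354) — line «es-polymer-decoupling», reshaped engine, input (c3): THE TWO-REGION RATIO
IDENTITY OF A KOTECKÝ–PREISS GAS

Helper module for item `stmt-QuantumFields-19354` (`--supports … --as helper`; it closes nothing; lead prover
ym-ir-line-mxc-p1 g2).  Abstract hard-core gas in a KP volume `Λ` ([KP86, (5)] in the tree:
`polymerPartitionFunction_sdiff_div_eq_exp`): for two sets of excluded polymers `D₁, D₂`,

  `Ξ(Λ ∖ (D₁ ∪ D₂)) · Ξ(Λ) = Ξ(Λ ∖ D₁) · Ξ(Λ ∖ D₂) · exp (S₁₂)`,  `S₁₂ = ∑_{C ⊆ Λ, C meets D₁ and D₂} Φ^T(C)`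

(`polymerPartitionFunction_sdiff_union_mul_eq`, inclusion–exclusion on the cluster sums), so that the joint law of two
anchored parts of the gas differs from the product law by the factor `exp (S₁₂)`, with `‖exp S₁₂ − 1‖ ≤ 2 ‖S₁₂‖` for
`‖S₁₂‖ ≤ 1` (Mathlib `Complex.norm_exp_sub_one_le`) and `‖S₁₂‖` controlled by the two-region cluster tail
(`Theorems/IR/EsPolymerClusterTail.lean`) when `D₁`, `D₂` are the polymers meeting two distant cell regions.

HONEST FRAMING: bookkeeping for an OPEN engine stub of a CONDITIONAL rung line; nothing about Yang–Mills is proved here. -/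

set_option autoImplicit false

noncomputable section

open Finset
open Literature.Probability.LatticeModels (IsCompatible polymerPartitionFunction IsKPVolume truncatedWeight
  polymerPartitionFunction_ne_zero_of_kp polymerPartitionFunction_sdiff_div_eq_exp)

namespace Summit.QuantumFields.YangMills.Cruxes.IR.EsPolymer

section Ratios

variable {P : Type*} [DecidableEq P] {inc : P → P → Prop} [DecidableRel inc] [Std.Refl inc] [Std.Symm inc]

omit [DecidableRel inc] [Std.Refl inc] [Std.Symm inc] in
/-- Inclusion–exclusion for the cluster sums: meeting `D₁ ∪ D₂` = meeting `D₁` + meeting `D₂` − meeting both. -/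
theorem sum_filter_meets_union_eq {M : Type*} [AddCommGroup M] (f : Finset P → M) (𝒮 : Finset (Finset P))
    (D₁ D₂ : Finset P) :
    ∑ C ∈ 𝒮 with (C ∩ (D₁ ∪ D₂)).Nonempty, f C =
      ∑ C ∈ 𝒮 with (C ∩ D₁).Nonempty, f C + ∑ C ∈ 𝒮 with (C ∩ D₂).Nonempty, f C -
        ∑ C ∈ 𝒮 with ((C ∩ D₁).Nonempty ∧ (C ∩ D₂).Nonempty), f C := by
  simp only [sum_filter]
  rw [← sum_add_distrib, ← sum_sub_distrib]
  refine sum_congr rfl fun C _ => ?_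
  have hiff : (C ∩ (D₁ ∪ D₂)).Nonempty ↔ (C ∩ D₁).Nonempty ∨ (C ∩ D₂).Nonempty := by
    rw [inter_union_distrib_left, union_nonempty]
  by_cases h1 : (C ∩ D₁).Nonempty <;> by_cases h2 : (C ∩ D₂).Nonempty <;> simp [hiff, h1, h2]

/-- **The two-region ratio identity** ([KP86, (5)] twice and inclusion–exclusion): in a KP volume `Λ`,
`Ξ(Λ ∖ (D₁ ∪ D₂)) · Ξ(Λ) = Ξ(Λ ∖ D₁) · Ξ(Λ ∖ D₂) · exp (∑_{C ⊆ Λ meeting D₁ and D₂} Φ^T(C))`. -/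
theorem polymerPartitionFunction_sdiff_union_mul_eq {w : P → ℂ} {a : P → ℝ} {Λ : Finset P} (hKP : IsKPVolume inc w a Λ)
    (D₁ D₂ : Finset P) :
    polymerPartitionFunction inc w (Λ \ (D₁ ∪ D₂)) * polymerPartitionFunction inc w Λ =
      polymerPartitionFunction inc w (Λ \ D₁) * polymerPartitionFunction inc w (Λ \ D₂) *
        Complex.exp (∑ C ∈ Λ.powerset with ((C ∩ D₁).Nonempty ∧ (C ∩ D₂).Nonempty), truncatedWeight inc w C) := by
  set Z := polymerPartitionFunction inc w Λ with hZ
  have hZ0 : Z ≠ 0 := polymerPartitionFunction_ne_zero_of_kp hKP subset_rfl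
  have hr : ∀ D : Finset P, polymerPartitionFunction inc w (Λ \ D) =
      Z * Complex.exp (-∑ C ∈ Λ.powerset with (C ∩ D).Nonempty, truncatedWeight inc w C) := fun D => by
    rw [← polymerPartitionFunction_sdiff_div_eq_exp (D := D) hKP, mul_div_cancel₀ _ hZ0]
  rw [hr (D₁ ∪ D₂), hr D₁, hr D₂, sum_filter_meets_union_eq]
  rw [show ∀ x y s : ℂ, Z * Complex.exp (-(x + y - s)) * Z = Z * Complex.exp (-x) * (Z * Complex.exp (-y)) * Complex.exp s
    from fun x y s => by
      rw [show -(x + y - s) = -x + -y + s by ring, Complex.exp_add, Complex.exp_add]; ring]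

/-- **The joint-to-product correction is small**: with `S₁₂` the two-region cluster sum, `‖S₁₂‖ ≤ 1` gives
`‖Ξ(Λ∖(D₁∪D₂)) Ξ(Λ) − Ξ(Λ∖D₁) Ξ(Λ∖D₂)‖ ≤ 2 ‖S₁₂‖ · ‖Ξ(Λ∖D₁)‖ ‖Ξ(Λ∖D₂)‖`. -/
theorem norm_sdiff_union_mul_sub_le {w : P → ℂ} {a : P → ℝ} {Λ : Finset P} (hKP : IsKPVolume inc w a Λ)
    (D₁ D₂ : Finset P)
    (hS : ‖∑ C ∈ Λ.powerset with ((C ∩ D₁).Nonempty ∧ (C ∩ D₂).Nonempty), truncatedWeight inc w C‖ ≤ 1) :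
    ‖polymerPartitionFunction inc w (Λ \ (D₁ ∪ D₂)) * polymerPartitionFunction inc w Λ -
        polymerPartitionFunction inc w (Λ \ D₁) * polymerPartitionFunction inc w (Λ \ D₂)‖ ≤
      2 * ‖∑ C ∈ Λ.powerset with ((C ∩ D₁).Nonempty ∧ (C ∩ D₂).Nonempty), truncatedWeight inc w C‖ *
        (‖polymerPartitionFunction inc w (Λ \ D₁)‖ * ‖polymerPartitionFunction inc w (Λ \ D₂)‖) := by
  rw [polymerPartitionFunction_sdiff_union_mul_eq hKP D₁ D₂]
  set S := ∑ C ∈ Λ.powerset with ((C ∩ D₁).Nonempty ∧ (C ∩ D₂).Nonempty), truncatedWeight inc w C with hSdef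
  set A := polymerPartitionFunction inc w (Λ \ D₁) with hA
  set B := polymerPartitionFunction inc w (Λ \ D₂) with hB
  calc ‖A * B * Complex.exp S - A * B‖ = ‖A * B * (Complex.exp S - 1)‖ := by ring_nf
    _ = ‖A‖ * ‖B‖ * ‖Complex.exp S - 1‖ := by rw [norm_mul, norm_mul]
    _ ≤ ‖A‖ * ‖B‖ * (2 * ‖S‖) := mul_le_mul_of_nonneg_left (Complex.norm_exp_sub_one_le hS) (by positivity)
    _ = 2 * ‖S‖ * (‖A‖ * ‖B‖) := by ring

end Ratios

end Summit.QuantumFields.YangMills.Cruxes.IR.EsPolymer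

end
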